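import Mathlib
import Summits.Ventures.HodgeRepro2.T5RecordSatakeDifferent
import Summits.Ventures.HodgeRepro2.T5CyclotomicSubfieldHeckeIntegral

/-!
# THE RELATIVE DIFFERENT OF A CM SUBFIELD OF `ℚ(ζₘ)` OVER ITS REAL SUBFIELD IS SUPPORTED ABOVE `m`

Tier-5 support N3 / §G-N4.2 (seat p3, gen 82). File 313 bounds the exceptional set of the record's Hecke
commutativity by the support of the relative different `𝔇_{F/F⁺}` for every CM field; file 304 / 312 bound it by
the places above `m` for the CM subfields of `ℚ(ζₘ)`. The two bounds are compatible: a prime of `F` above `p ∤ m`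
does not divide `𝔇_{F/F⁺}` (file 47's `e(𝔭/p) = 1`, the tower law `e(𝔭/p) = e(v/p) e(𝔭/v)`, and Mathlib's
`not_dvd_differentIdeal_iff` through `ramificationIdx_eq_one_iff`).

* **`not_dvd_differentIdeal_of_coprime`** — `𝔭 ∤ 𝔇_{F/F⁺}` for every prime `𝔭` of `F` above `p ∤ m`;
* **`mem_of_dvd_differentIdeal`** — a prime divisor of `𝔇_{F/F⁺}` lies above a prime dividing `m`:
  `(m : 𝓞_{F⁺}) ∈ w.under`; **`setOf_exists_dvd_differentIdeal_subset`** — the places of `F⁺` under a divisor of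
  the different are among the places containing `m`;
* **`setOf_not_recordCommutative_subset`** — the chain for an integral unimodular `H`: {not commutative} ⊆ {under a
  divisor of `𝔇`} ⊆ {containing `m`}.

§8(d): uses an L-value-free non-vanishing device: NO.
-/

open Matrix NumberField NumberField.IsCMField IsDedekindDomain IsDedekindDomain.HeightOneSpectrum Module Polynomial
  Ideal
open scoped TensorProduct Pointwise
open Summit.Ventures.HodgeRepro2.T5UnitaryGroupForm Summit.Ventures.HodgeRepro2.T5UnitaryHeckeAdjoint
  Summit.Ventures.HodgeRepro2.T5HeckePermutationModule Summit.Ventures.HodgeRepro2.T5HeckeDoubleCoset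
  Summit.Ventures.HodgeRepro2.T5RecordHyperspecial Summit.Ventures.HodgeRepro2.T5GlobalLatticeAlmostAll
  Summit.Ventures.HodgeRepro2.T5FinitePlaceSplitClassification Summit.Ventures.HodgeRepro2.T5RecordSatakeIntrinsic
  Summit.Ventures.HodgeRepro2.T5SplitPlaceUnitaryGroup Summit.Ventures.HodgeRepro2.T5NonSplitPlaceUnitaryGroup
  Summit.Ventures.HodgeRepro2.T5FinitePlaceCM Summit.Ventures.HodgeRepro2.T5StarOfInvolution
  Summit.Ventures.HodgeRepro2.T5CyclotomicSubfieldHeckeCommutative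
  Summit.Ventures.HodgeRepro2.T5CyclotomicSubfieldInertiaDeg
  Summit.Ventures.HodgeRepro2.T5IntegralGramBadSet Summit.Ventures.HodgeRepro2.T5RecordSatakeDifferent
  Summit.Ventures.HodgeRepro2.T5CyclotomicSubfieldHeckeIntegral

namespace Summit.Ventures.HodgeRepro2.T5CyclotomicSubfieldDifferent

variable (m : ℕ) [NeZero m] (L : Type*) [Field L] [NumberField L] [IsCyclotomicExtension {m} ℚ L] [IsCMField L]
  (F : IntermediateField ℚ L) [IsCMField F]

section Coprime

variable (p : ℕ) [hp : Fact p.Prime] (hpm : p.Coprime m)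
  (𝔭 : Ideal (𝓞 F)) [h𝔭 : 𝔭.IsPrime] [h𝔭p : 𝔭.LiesOver (span {(p : ℤ)})]

omit [IsCMField L] [IsCMField F] in
include hpm h𝔭 h𝔭p in
/-- **A prime of `F` above `p ∤ m` does not divide the relative different `𝔇_{F/F⁺}`**: `e(𝔭/p) = 1` (file 47), so
`e(𝔭/v) = 1` by the tower law, so `𝔭` is unramified over `F⁺` (Mathlib's `ramificationIdx_eq_one_iff`, the residue
field being perfect) and does not divide the different (`not_dvd_differentIdeal_iff`). -/
theorem not_dvd_differentIdeal_of_coprime :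
    ¬ 𝔭 ∣ differentIdeal (𝓞 (maximalRealSubfield F)) (𝓞 F) := by
  have h1 : 𝔭.ramificationIdx ℤ = 1 :=
    T5CyclotomicUnramified.ramificationIdx_eq_one p L F ((Nat.Prime.coprime_iff_not_dvd hp.out).mp hpm) 𝔭
  have hsp : (span {(p : ℤ)} : Ideal ℤ) ≠ ⊥ :=
    (Ideal.span_singleton_eq_bot).not.mpr (Nat.cast_ne_zero.mpr hp.out.ne_zero)
  haveI : (𝔭.under (𝓞 (maximalRealSubfield F))).LiesOver (span {(p : ℤ)}) :=
    Ideal.LiesOver.tower_bot 𝔭 (𝔭.under (𝓞 (maximalRealSubfield F))) _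
  have htower := Ideal.ramificationIdx'_algebra_tower' (span {(p : ℤ)}) (𝔭.under (𝓞 (maximalRealSubfield F))) 𝔭
  rw [Ideal.ramificationIdx'_eq_ramificationIdx (span {(p : ℤ)}) 𝔭 hsp, h1] at htower
  have hev : (𝔭.under (𝓞 (maximalRealSubfield F))).ramificationIdx' 𝔭 = 1 :=
    Nat.eq_one_of_mul_eq_one_left htower.symm
  have hv0 : 𝔭.under (𝓞 (maximalRealSubfield F)) ≠ ⊥ :=
    Ideal.ne_bot_of_liesOver_of_ne_bot hsp (𝔭.under (𝓞 (maximalRealSubfield F)))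
  have he : 𝔭.ramificationIdx (𝓞 (maximalRealSubfield F)) = 1 := by
    rw [← Ideal.ramificationIdx'_eq_ramificationIdx (𝔭.under (𝓞 (maximalRealSubfield F))) 𝔭 hv0]
    exact hev
  haveI : Algebra.IsUnramifiedAt (𝓞 (maximalRealSubfield F)) 𝔭 := (Ideal.ramificationIdx_eq_one_iff).mp he
  exact not_dvd_differentIdeal_iff.mpr inferInstance

end Coprime

section Support

omit [IsCMField L] [IsCMField F] in
/-- **A prime divisor of `𝔇_{F/F⁺}` lies above a prime dividing `m`**: `(m : 𝓞_{F⁺}) ∈ w.under`. -/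
theorem mem_of_dvd_differentIdeal (w : HeightOneSpectrum (𝓞 F))
    (hw : w.asIdeal ∣ differentIdeal (𝓞 (maximalRealSubfield F)) (𝓞 F)) :
    ((m : ℕ) : 𝓞 (maximalRealSubfield F)) ∈ w.asIdeal.under (𝓞 (maximalRealSubfield F)) := by
  by_contra hmv
  let v : HeightOneSpectrum (𝓞 (maximalRealSubfield F)) :=
    ⟨w.asIdeal.under (𝓞 (maximalRealSubfield F)), Ideal.IsPrime.under _ _,
      fun hbot => w.ne_bot (Ideal.eq_bot_of_comap_eq_bot hbot)⟩
  obtain ⟨p, hp, hpm, hv⟩ := exists_prime_liesOver_of_notMem m L F v hmv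
  haveI : Fact p.Prime := ⟨hp⟩
  haveI : w.asIdeal.LiesOver v.asIdeal := Ideal.over_under w.asIdeal
  haveI : w.asIdeal.LiesOver (span {(p : ℤ)}) := Ideal.LiesOver.trans w.asIdeal v.asIdeal (span {(p : ℤ)})
  exact not_dvd_differentIdeal_of_coprime m L F p hpm w.asIdeal hw

omit [IsCMField L] [IsCMField F] in
/-- **The places of `F⁺` under a divisor of the different are among the places containing `m`.** -/
theorem setOf_exists_dvd_differentIdeal_subset :
    {v : HeightOneSpectrum (𝓞 (maximalRealSubfield F)) | ∃ w : HeightOneSpectrum (𝓞 F),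
        w.asIdeal.LiesOver v.asIdeal ∧ w.asIdeal ∣ differentIdeal (𝓞 (maximalRealSubfield F)) (𝓞 F)} ⊆
      {v : HeightOneSpectrum (𝓞 (maximalRealSubfield F)) | ((m : ℕ) : 𝓞 (maximalRealSubfield F)) ∈ v.asIdeal} := by
  rintro v ⟨w, hwv, hw⟩
  have h := mem_of_dvd_differentIdeal m L F w hw
  rw [← hwv.over] at h
  exact h

variable {r : ℕ} (l : Fin r → 𝓞 F) (k : Type*) [Field k]
  (hl : Submodule.span (𝓞 (maximalRealSubfield F)) (Set.range l) = ⊤)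
variable (M : Matrix (Fin 3) (Fin 3) (𝓞 F)) (hM : IsUnit M.det)
  (hH : ((algebraMap (𝓞 F) F).mapMatrix M).IsHermitian)

omit [IsCMField L] in
include hl hM hH in
/-- **THE CHAIN FOR AN INTEGRAL UNIMODULAR `H`**: {places where the algebra is not commutative} ⊆ {places under a
divisor of `𝔇_{F/F⁺}`} ⊆ {places containing `m`} (files 313 and 312 agree, through the different). -/
theorem setOf_not_recordCommutative_subset :
    {v : HeightOneSpectrum (𝓞 (maximalRealSubfield F)) |
        ¬ RecordCommutative F v l k ((algebraMap (𝓞 F) F).mapMatrix M)} ⊆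
      {v : HeightOneSpectrum (𝓞 (maximalRealSubfield F)) | ∃ w : HeightOneSpectrum (𝓞 F),
        w.asIdeal.LiesOver v.asIdeal ∧ w.asIdeal ∣ differentIdeal (𝓞 (maximalRealSubfield F)) (𝓞 F)} ∧
    {v : HeightOneSpectrum (𝓞 (maximalRealSubfield F)) | ∃ w : HeightOneSpectrum (𝓞 F),
        w.asIdeal.LiesOver v.asIdeal ∧ w.asIdeal ∣ differentIdeal (𝓞 (maximalRealSubfield F)) (𝓞 F)} ⊆
      {v : HeightOneSpectrum (𝓞 (maximalRealSubfield F)) | ((m : ℕ) : 𝓞 (maximalRealSubfield F)) ∈ v.asIdeal} :=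
  ⟨subset_setOf_exists_dvd_differentIdeal F l k hl M hM hH, setOf_exists_dvd_differentIdeal_subset m L F⟩

end Support

end Summit.Ventures.HodgeRepro2.T5CyclotomicSubfieldDifferent
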